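import Literature.Probability.Percolation.QuadCrossingSeparatorArmMid
import Literature.Probability.Percolation.QuadCrossingFreshArms
import Literature.Probability.Percolation.QuadDualExploration
import HarnessLib

/-!
# The middle open arm of the dual picture (Lemma 6.1, case (3), cut-free)

Topic `Probability/Percolation`; proofs file towards the named fact `SchrammSmirnov2011_lemma_6_1`
(`QuadCrossingContinuity.lean`; O. Schramm, S. Smirnov, *On the scaling limits of planar
percolation*, Ann. Probab. 39 (2011), arXiv:1101.5820, proof of Lemma 6.1, p. 23: "the proof in
case (3) is symmetric to that of case (2)").

The dual counterpart of `Quad.mem_annulusDualCrossingOff_mid` (`QuadCrossingSeparatorArmMid.lean`):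
the walls are now a low dual crossing with its exit set (`W`, region `M` below it) and a high dual
crossing with its exit set (`W'`, region `M'` above it), and the separator is an OPEN transversal
crossing of the big quad (from `∂₁Q ⊆ M` to `∂₃Q ⊆ M'`).  Its excursion outside `M ∪ M'`
(`Quad.exists_excursion`) runs from `E` to `E'`, has diameter `≥ d₁(Q) - 2c₃ - 4R₁` when the two
wall points are close to `∂₃Q` and `∂₁Q` respectively, and therefore crosses one of the two middle
annuli about `x` (`Quad.midInner`, `Quad.midOuter`) by an open arm using no edge of a set `S` of
edges whose open segments leave `M ∪ M'` only next to `x` or `x'`: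
`Quad.mem_annulusOpenCrossingOff_mid`.  Everything is proved.

## References

* O. Schramm, S. Smirnov, Ann. Probab. 39 (2011) 1768–1814, arXiv:1101.5820, proof of Lemma 6.1,
  cases (2)–(3). [SchrammSmirnov2011]
-/

noncomputable section

open scoped unitInterval
open Set Filter Metric Function
open _root_.Topology
open Literature.Probability.LatticeModels

namespace Literature.Probability.Percolation

namespace QuadCrossing

variable {D : Set ℂ}

namespace Quad

variable {Q : Quad D}

/-- **The middle open arm of the dual picture** (see the module docstring).
[cite: SchrammSmirnov2011, proof of Lemma 6.1, case (3) via case (2), eq. (6.2)] -/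
theorem mem_annulusOpenCrossingOff_mid {δ : ℝ} (hδ : 0 < δ) {ω : BondConfig (Site 2)}
    {W E : Set ℂ} (hWc : IsCompact W) (hWconn : IsPreconnected W) (hWQ : W ⊆ Q.carrier)
    (hW0 : (W ∩ Q.side 0).Nonempty) (hW2 : (W ∩ Q.side 2).Nonempty)
    (hWO : ∀ z ∈ W, z ∈ openEdgeUnion δ ω → z ∈ E) {x : ℂ} {R₁ : ℝ} (hR₁ : 0 ≤ R₁)
    (hEjoin : ∀ e ∈ E, ∃ p : Path x e, range p ⊆ Q.carrier ∧ ∀ s, dist (p s) x ≤ R₁)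
    {W' E' : Set ℂ} (hW'c : IsCompact W') (hW'conn : IsPreconnected W') (hW'Q' : W' ⊆ Q.carrier)
    (hW'0' : (W' ∩ Q.side 0).Nonempty) (hW'2' : (W' ∩ Q.side 2).Nonempty)
    (hW'O : ∀ z ∈ W', z ∈ openEdgeUnion δ ω → z ∈ E') {x' : ℂ}
    (hE'join : ∀ e ∈ E', ∃ p : Path x' e, range p ⊆ Q.carrier ∧ ∀ s, dist (p s) x' ≤ R₁)
    (hEM' : ∀ e ∈ E, e ∉ {z | z ∈ Q.carrier ∧ ∀ t ∈ Q.side 1, ∀ p : Path z t,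
      range p ⊆ Q.carrier → (range p ∩ W').Nonempty})
    {c₃ : ℝ}
    (hnear₃ : ∃ t ∈ Q.side 3, ∃ p : Path x t, range p ⊆ Q.carrier ∧ Metric.diam (range p) < c₃)
    (hnear₁ : ∃ t ∈ Q.side 1, ∃ p : Path x' t, range p ⊆ Q.carrier ∧ Metric.diam (range p) < c₃)
    {r₀ ρm R₀ : ℝ} (hR₁r : R₁ < r₀) (hslack₁ : r₀ + 2 * δ ≤ ρm) (hslack₂ : 3 * ρm + 2 * δ ≤ R₀)
    (hR₀ : 2 * R₀ + 2 * c₃ + 4 * R₁ ≤ Q.sideDist 1) {S : Set (Sym2 (Site 2))}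
    (hS : ∀ a b : Site 2, (zdGraph 2).Adj a b → s(a, b) ∈ S → s(a, b) ∈ ω →
      ∀ q ∈ segment ℝ (meshPoint δ a) (meshPoint δ b), q ∈ Q.carrier →
        q ∉ {z | z ∈ Q.carrier ∧ ∀ t ∈ Q.side 3, ∀ p : Path z t,
          range p ⊆ Q.carrier → (range p ∩ W).Nonempty} →
        q ∉ {z | z ∈ Q.carrier ∧ ∀ t ∈ Q.side 1, ∀ p : Path z t,
          range p ⊆ Q.carrier → (range p ∩ W').Nonempty} →
        dist q x < r₀ ∨ dist q x' < r₀)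
    (hKop : ∃ Kset : Set ℂ, IsCompact Kset ∧ IsConnected Kset ∧ Kset ⊆ Q.carrier ∧
      Kset ⊆ openEdgeUnion δ ω ∧ (Kset ∩ Q.side 1).Nonempty ∧ (Kset ∩ Q.side 3).Nonempty) :
    ω ∈ annulusOpenCrossingOff S x δ (midInner (dist x' x) r₀ ρm + δ)
      (midOuter (dist x' x) ρm R₀ - δ) := by
  -- radii
  set inner : ℝ := midInner (dist x' x) r₀ ρm with hinner
  set outer : ℝ := midOuter (dist x' x) ρm R₀ with houter
  obtain ⟨hr₀i, hio, hoR⟩ := midRadii_spec (dist x' x) (hR₁.trans hR₁r.le) hslack₁ hslack₂ hδ.le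
  have hρm : r₀ ≤ ρm := by linarith
  have hio' : inner < outer := by rw [hinner, houter]; linarith
  have hexcl : ∀ q : ℂ, inner ≤ dist q x → dist q x ≤ outer → r₀ ≤ dist q x' := fun q h1 h2 =>
    le_dist_of_midRadii rfl hρm h1 h2
  -- junctions are close
  have hEx : ∀ e ∈ E, dist e x ≤ R₁ := fun e he => by
    obtain ⟨p, -, hp⟩ := hEjoin e he
    simpa [p.target] using hp 1
  have hE'x : ∀ e ∈ E', dist e x' ≤ R₁ := fun e he => by
    obtain ⟨p, -, hp⟩ := hE'join e he
    simpa [p.target] using hp 1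
  -- the open separator of `Q` as a map `β : ℝ → ℂ`
  obtain ⟨Kset, hKsc, hKsconn, hKsQ, hKsO, ⟨a₁, ha₁K, ha₁⟩, ⟨a₃, ha₃K, ha₃⟩⟩ := hKop
  have hJκ := joinedIn_inter_openEdgeUnion_of_isConnected hδ hKsc hKsconn hKsO hKsQ ha₁K ha₃K
  set κ : Path a₁ a₃ := hJκ.somePath with hκ
  have hκmem : ∀ t, κ t ∈ Q.carrier ∩ openEdgeUnion δ ω := hJκ.somePath_mem
  set β : ℝ → ℂ := fun s => κ.extend s with hβdef
  have hβc : ContinuousOn β (Icc 0 1) := κ.continuous_extend.continuousOn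
  have hβmem : ∀ s, β s ∈ Q.carrier ∩ openEdgeUnion δ ω := fun s => hκmem _
  have hβQ : MapsTo β (Icc 0 1) Q.carrier := fun s _ => (hβmem s).1
  have hβ0 : β 0 ∈ Q.side 1 := by simp only [hβdef, Path.extend_zero]; exact ha₁
  have hβ1 : β 1 ∈ Q.side 3 := by simp only [hβdef, Path.extend_one]; exact ha₃
  have hβO : ∀ t ∈ Icc (0 : ℝ) 1, β t ∈ openEdgeUnion δ ω := fun t _ => (hβmem t).2
  -- the two walls and their regions
  have hW'Q : W' ⊆ Q.flip.carrier := by rw [flip_carrier]; exact hW'Q'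
  have hW'0 : (W' ∩ Q.flip.side 0).Nonempty := by rw [flip_side_zero]; exact hW'0'
  have hW'2 : (W' ∩ Q.flip.side 2).Nonempty := by rw [flip_side_two]; exact hW'2'
  set M : Set ℂ := {z | z ∈ Q.carrier ∧ ∀ t ∈ Q.side 3, ∀ p : Path z t,
      range p ⊆ Q.carrier → (range p ∩ W).Nonempty} with hM
  set M' : Set ℂ := {z | z ∈ Q.flip.carrier ∧ ∀ t ∈ Q.flip.side 3, ∀ p : Path z t,
      range p ⊆ Q.flip.carrier → (range p ∩ W').Nonempty} with hM'
  have hM'eq : M' = {z | z ∈ Q.carrier ∧ ∀ t ∈ Q.side 1, ∀ p : Path z t,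
      range p ⊆ Q.carrier → (range p ∩ W').Nonempty} := Q.flip_below_eq W'
  -- `β 0` is below `W`, `β 1` is above `W'`
  have hβ0M : β 0 ∈ M := Quad.side_one_subset_below hWc hWconn hWQ hW0 hW2 hβ0
  have hβ1M' : β 1 ∈ M' := by
    have h1 : β 1 ∈ Q.flip.side 1 := by rw [flip_side_one]; exact hβ1
    exact Quad.side_one_subset_below hW'c hW'conn hW'Q hW'0 hW'2 h1
  -- contacts of `β` with `W` are in `E`, hence not above `W'`
  have hβE : ∀ t ∈ Icc (0 : ℝ) 1, β t ∈ W → β t ∈ E := fun t ht h => hWO _ h (hβO t ht)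
  have hβW : ∀ t ∈ Icc (0 : ℝ) 1, β t ∈ W → β t ∉ M' := fun t ht h => by
    rw [hM'eq]; exact hEM' _ (hβE t ht h)
  -- the excursion
  obtain ⟨sσ, sτ, hσ0, hστ, hτ1, hσW, hτW', hexc⟩ :=
    Quad.exists_excursion hWc.isClosed hW'c.isClosed hβc hβQ hβ0M hβ1 hβ1M' hβW
  have hσI : sσ ∈ Icc (0 : ℝ) 1 := ⟨hσ0, hστ.le.trans hτ1⟩
  have hτI : sτ ∈ Icc (0 : ℝ) 1 := ⟨hσ0.trans hστ.le, hτ1⟩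
  have hσE : β sσ ∈ E := hβE sσ hσI hσW
  have hτE' : β sτ ∈ E' := hW'O _ hτW' (hβO sτ hτI)
  -- reparametrise the excursion: `γ : [0,1] → [Q]` from `β sσ ∈ E` to `β sτ ∈ E'`
  obtain ⟨hγc, hγ0, hγ1, hγmaps⟩ := exists_reparam hβc hσ0 hστ.le hτ1
  set γ : ℝ → ℂ := fun t => β (sσ + t * (sτ - sσ)) with hγ
  have hγI : ∀ t ∈ Icc (0 : ℝ) 1, sσ + t * (sτ - sσ) ∈ Icc (0 : ℝ) 1 := fun t ht =>
    let h := hγmaps t ht; ⟨hσ0.trans h.1, h.2.trans hτ1⟩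
  have hγO : ∀ t ∈ Icc (0 : ℝ) 1, γ t ∈ openEdgeUnion δ ω := fun t ht => hβO _ (hγI t ht)
  have hγQ : ∀ t ∈ Icc (0 : ℝ) 1, γ t ∈ Q.carrier := fun t ht => hβQ (hγI t ht)
  have hγout : ∀ t ∈ Ioo (0 : ℝ) 1, γ t ∉ M ∧ γ t ∉ M' := fun t ht => by
    refine hexc (sσ + t * (sτ - sσ)) ⟨?_, ?_⟩
    · nlinarith [ht.1]
    · nlinarith [ht.2]
  have hγ0x : dist (γ 0) x ≤ R₁ := by rw [hγ0]; exact hEx _ hσE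
  have hγ1x' : dist (γ 1) x' ≤ R₁ := by rw [hγ1]; exact hE'x _ hτE'
  -- the excursion has diameter `≥ 2 R₀`: chain it with the short junctions into a `∂₁Q–∂₃Q` path
  obtain ⟨pγ, hpγ⟩ := exists_path_of_continuousOn hγc
  have hpγr : range pγ ⊆ γ '' Icc 0 1 := by
    rintro _ ⟨t, rfl⟩; exact ⟨t, t.2, (hpγ t).symm⟩
  have hpγQ : range pγ ⊆ Q.carrier := hpγr.trans (by rintro _ ⟨t, ht, rfl⟩; exact hγQ t ht)
  have hdiamγ : 2 * R₀ ≤ Metric.diam (range pγ) := by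
    obtain ⟨t₃, ht₃, p₃, hp₃Q, hp₃d⟩ := hnear₃
    obtain ⟨t₁, ht₁, p₁, hp₁Q, hp₁d⟩ := hnear₁
    obtain ⟨j₀, hj₀Q, hj₀⟩ := hEjoin _ (show γ 0 ∈ E by rw [hγ0]; exact hσE)
    obtain ⟨j₁, hj₁Q, hj₁⟩ := hE'join _ (show γ 1 ∈ E' by rw [hγ1]; exact hτE')
    have hdj₀ : Metric.diam (range j₀) ≤ 2 * R₁ := by
      refine Metric.diam_le_of_forall_dist_le (by positivity) ?_
      rintro _ ⟨a, rfl⟩ _ ⟨b, rfl⟩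
      linarith [dist_triangle (j₀ a) x (j₀ b), dist_comm x (j₀ b), hj₀ a, hj₀ b]
    have hdj₁ : Metric.diam (range j₁) ≤ 2 * R₁ := by
      refine Metric.diam_le_of_forall_dist_le (by positivity) ?_
      rintro _ ⟨a, rfl⟩ _ ⟨b, rfl⟩
      linarith [dist_triangle (j₁ a) x' (j₁ b), dist_comm x' (j₁ b), hj₁ a, hj₁ b]
    -- the chain `t₁ → x' → γ 1 → γ 0 → x → t₃`
    let big : Path t₁ t₃ := p₁.symm.trans (j₁.trans (pγ.symm.trans (j₀.symm.trans p₃)))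
    have hbig_range : range big = range p₁ ∪ (range j₁ ∪ (range pγ ∪ (range j₀ ∪ range p₃))) := by
      simp only [big, Path.trans_range, Path.symm_range]
    have hbigQ : range big ⊆ Q.carrier := by
      rw [hbig_range]
      exact union_subset hp₁Q (union_subset hj₁Q (union_subset hpγQ (union_subset hj₀Q hp₃Q)))
    have hd₁ : Q.sideDist 1 ≤ Metric.diam (range big) := Quad.sideDist_le (j := 1) ht₁ ht₃ big hbigQ
    -- diameters add along the chain
    have hx3 : x ∈ range j₀ ∩ range p₃ := ⟨⟨0, j₀.source⟩, ⟨0, p₃.source⟩⟩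
    have h4 : Metric.diam (range j₀ ∪ range p₃) ≤ 2 * R₁ + c₃ := by
      have := Metric.diam_union' ⟨x, hx3⟩; linarith
    have hγ0mem : γ 0 ∈ range pγ ∩ (range j₀ ∪ range p₃) :=
      ⟨⟨0, by rw [hpγ]; rfl⟩, Or.inl ⟨1, j₀.target⟩⟩
    have h3 : Metric.diam (range pγ ∪ (range j₀ ∪ range p₃)) ≤
        Metric.diam (range pγ) + (2 * R₁ + c₃) := by
      have := Metric.diam_union' ⟨γ 0, hγ0mem⟩; linarith
    have hγ1mem : γ 1 ∈ range j₁ ∩ (range pγ ∪ (range j₀ ∪ range p₃)) :=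
      ⟨⟨1, j₁.target⟩, Or.inl ⟨1, by rw [hpγ]; rfl⟩⟩
    have h2 : Metric.diam (range j₁ ∪ (range pγ ∪ (range j₀ ∪ range p₃))) ≤
        2 * R₁ + (Metric.diam (range pγ) + (2 * R₁ + c₃)) := by
      have := Metric.diam_union' ⟨γ 1, hγ1mem⟩; linarith
    have hx'mem : x' ∈ range p₁ ∩ (range j₁ ∪ (range pγ ∪ (range j₀ ∪ range p₃))) :=
      ⟨⟨0, p₁.source⟩, Or.inl ⟨0, j₁.source⟩⟩
    have h1 : Metric.diam (range big) ≤
        c₃ + (2 * R₁ + (Metric.diam (range pγ) + (2 * R₁ + c₃))) := by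
      rw [hbig_range]
      have := Metric.diam_union' ⟨x', hx'mem⟩; linarith
    linarith
  -- hence `γ` reaches distance `≥ R₀` from `x`
  have hfarpt : ∃ t ∈ Icc (0 : ℝ) 1, R₀ ≤ dist (γ t) x := by
    by_contra hcon
    push Not at hcon
    have hK : IsCompact (range pγ) := isCompact_range pγ.continuous
    obtain ⟨m₀, hm₀, hmax⟩ := hK.exists_isMaxOn ⟨γ 0, ⟨0, by rw [hpγ]; rfl⟩⟩
      (continuous_id.dist continuous_const).continuousOn
    have hm₀lt : dist m₀ x < R₀ := by
      obtain ⟨t, ht, hteq⟩ := hpγr hm₀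
      rw [← hteq]; exact hcon t ht
    have hbound : Metric.diam (range pγ) ≤ 2 * dist m₀ x := by
      refine Metric.diam_le_of_forall_dist_le (by positivity) fun u hu v hv => ?_
      have hu' : dist u x ≤ dist m₀ x := hmax hu
      have hv' : dist v x ≤ dist m₀ x := hmax hv
      linarith [dist_triangle u x v, dist_comm x v]
    linarith
  obtain ⟨t₁, ht₁, ht₁far⟩ := hfarpt
  -- restrict `γ` to `[0, t₁]`
  obtain ⟨hγ'c, hγ'0, hγ'1, hγ'maps⟩ := exists_reparam hγc le_rfl ht₁.1 ht₁.2
  set γ' : ℝ → ℂ := fun t => γ (0 + t * (t₁ - 0)) with hγ'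
  -- the last visit to `B̄(x, inner)`
  have h0lt : dist (γ' 0) x < inner := by rw [hγ'0]; linarith
  have h1gt : inner < dist (γ' 1) x := by rw [hγ'1]; linarith
  obtain ⟨u₀, hu₀, hu₀eq, hu₀after⟩ := exists_last_le (g := fun t => dist (γ' t) x)
    ((continuous_id.dist continuous_const).comp_continuousOn hγ'c) h0lt h1gt
  -- restrict to `[u₀, 1]`, then up to the first exit from `B(x, outer)`
  obtain ⟨hγ₂c, hγ₂0, hγ₂1, hγ₂maps⟩ := exists_reparam hγ'c hu₀.1.le hu₀.2.le le_rfl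
  set γ₂ : ℝ → ℂ := fun t => γ' (u₀ + t * (1 - u₀)) with hγ₂
  have h0 : dist (γ₂ 0) x < outer := by rw [hγ₂0, hu₀eq]; exact hio'
  have h1 : outer ≤ dist (γ₂ 1) x := by rw [hγ₂1, hγ'1]; linarith
  obtain ⟨γ₃, hγ₃c, hγ₃0, hγ₃mem, hγ₃R, hγ₃1⟩ := exists_restrict_until_dist_ge hγ₂c h0 h1
  -- every point of `γ₃` is a point `γ v` with `inner ≤ dist (γ v) x ≤ outer`
  have hγ₃pts : ∀ t ∈ Icc (0 : ℝ) 1, ∃ v ∈ Icc (0 : ℝ) 1, γ₃ t = γ v ∧ inner ≤ dist (γ v) x ∧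
      dist (γ v) x ≤ outer := by
    intro t ht
    obtain ⟨u, hu, hu'⟩ := hγ₃mem t ht
    obtain ⟨hw1, hw2⟩ := hγ₂maps u hu
    set w : ℝ := u₀ + u * (1 - u₀) with hw
    have hwI : w ∈ Icc (0 : ℝ) 1 := ⟨hu₀.1.le.trans hw1, hw2⟩
    obtain ⟨hv1, hv2⟩ := hγ'maps w hwI
    refine ⟨0 + w * (t₁ - 0), ⟨hv1, hv2.trans ht₁.2⟩, by rw [← hu'], ?_, ?_⟩
    · show inner ≤ dist (γ' w) x
      rcases hw1.eq_or_lt with h | h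
      · rw [← h, hu₀eq]
      · exact (hu₀after w hwI h).le
    · have := hγ₃R t ht
      rwa [← hu'] at this
  -- such points are strictly inside the excursion, hence off `M ∪ M'`
  have hγ₃out : ∀ t ∈ Icc (0 : ℝ) 1, ∃ v ∈ Icc (0 : ℝ) 1, γ₃ t = γ v ∧ γ v ∉ M ∧ γ v ∉ M' ∧
      r₀ ≤ dist (γ v) x ∧ r₀ ≤ dist (γ v) x' := by
    intro t ht
    obtain ⟨v, hv, hveq, hvin, hvout⟩ := hγ₃pts t ht
    have hvx' : r₀ ≤ dist (γ v) x' := hexcl _ hvin hvout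
    have hv0 : 0 < v := by
      rcases hv.1.eq_or_lt with h | h
      · exfalso; rw [← h] at hvin; linarith
      · exact h
    have hv1 : v < 1 := by
      rcases hv.2.eq_or_lt with h | h
      · exfalso; rw [h] at hvx'; linarith
      · exact h
    obtain ⟨hM₁, hM₂⟩ := hγout v ⟨hv0, hv1⟩
    exact ⟨v, hv, hveq, hM₁, hM₂, hr₀i.trans hvin, hvx'⟩
  have hγ₃O : ∀ t ∈ Icc (0 : ℝ) 1, γ₃ t ∈ openEdgeUnion δ (ω \ S) := by
    intro t ht
    obtain ⟨v, hv, hveq, hvM, hvM', hvx, hvx'⟩ := hγ₃out t ht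
    rw [hveq]
    obtain ⟨a, b, hab, hω, hseg⟩ := mem_openEdgeUnion_iff.1 (hγO v hv)
    refine mem_openEdgeUnion_iff.2 ⟨a, b, hab, ⟨hω, fun hSab => ?_⟩, hseg⟩
    rw [hM'eq] at hvM'
    rcases hS a b hab hSab hω (γ v) hseg (hγQ v hv) hvM hvM' with hd | hd'
    · linarith
    · linarith
  have h0' : dist (γ₃ 0) x ≤ inner := by rw [hγ₃0, hγ₂0, hu₀eq]
  exact mem_annulusOpenCrossingOff_iff.2
    (mem_annulusOpenCrossing_of_path hδ x hγ₃c hγ₃O h0' hγ₃R hγ₃1)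

end Quad

end QuadCrossing

end Literature.Probability.Percolation
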